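import Literature.Probability.Percolation.SlabRSWGluingNearOfCross
import Literature.Probability.Percolation.SlabRSWGluingHighProbExt
import HarnessLib

/-!
# Newman–Tassion–Wu 2017, Prop. 3.9 (3.28) in the high-probability regime, assembled: the `ε-δ` GL0
# for a TOP extension of a rectangle (`Γ` left-to-right in `S`, the long crossing top-to-bottom in `R`)

Topic: `Literature/Probability/Percolation`. Puts together `glue_highProb_ext` (Thm 3.7, high-probability
regime, extended rectangle), `GlueData.real_evNear_ge_of_cross₂` (two-domain planar crossing ⇒ near
event) and the planar fact `cross₂_of_topExt` (this file): for `S = [a,b]×[c,d] ⊆ R = [a,b]×[c,d']`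
(p2's `ExtSetup` with `b' = b`), `A` on the column `x = a` inside `S`, `B = {b}×[c,d]`, `C` on the row
`y = d'` and `D'` on the row `y = c`, with `dist*(A,C) > 4ρ+8` and `dist*(C,S) > 2ρ+3`: for every
`η > 0` there is `δ > 0` (uniform) such that `P[A ⟷^S B] ≥ 1 - δ` and `P[C ⟷^R D'] ≥ 1 - δ` imply
`P[C ⟷^R A] ≥ 1 - η` — the transposed form of the first gluing (3.28) of NTW's Prop. 3.9 (1) near `1`.

* `NTW17.cross₂_of_topExt`, **`NTW17.glue0_highProb_topExt`**.

## Sources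

* C. M. Newman, V. Tassion, W. Wu, *Critical percolation and the minimal spanning tree in slabs*,
  Comm. Pure Appl. Math. 70 (2017), arXiv:1512.09107: Proposition 3.9 (proof, (3.27)–(3.29)),
  Theorem 3.6/3.7 (high-probability regime) [NewmanTassionWu2017].
-/

noncomputable section

namespace Literature.Probability.Percolation

open MeasureTheory LatticeModels SimpleGraph

namespace NTW17

variable {k : ℕ}

/-- **The two-domain planar crossing for a top extension** (the transposed picture of (3.28)): in
`S = [a,b]×[c,d] ⊆ R = [a,b]×[c,d']`, every planar walk in `S` from the column `x = a` to the column
`x = b` meets every planar walk in `R` from the row `y = d'` to the row `y = c` (the latter's final portion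
after its last visit to `{y ≥ d}` is a top-bottom crossing of `S`).
[cite: NewmanTassionWu2017, Proposition 3.9 (proof, (3.28))] -/
theorem cross₂_of_topExt {a b c d d' : ℤ} (hcd : c < d) (hdd' : d ≤ d') {A B C Dd : Set (ℤ × ℤ)}
    (hA : ∀ z ∈ A, z.1 = a) (hB : ∀ z ∈ B, z.1 = b) (hC : ∀ z ∈ C, z.2 = d') (hD : ∀ z ∈ Dd, z.2 = c) :
    ∀ (l₁ l₂ : List (ℤ × ℤ)) (h₁ : l₁ ≠ []) (h₂ : l₂ ≠ []), IsPlanarWalk l₁ → IsPlanarWalk l₂ →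
      (∀ z ∈ l₁, z ∈ boxR a b c d) → (∀ z ∈ l₂, z ∈ boxR a b c d') → l₁.head h₁ ∈ A → l₁.getLast h₁ ∈ B →
      l₂.head h₂ ∈ C → l₂.getLast h₂ ∈ Dd → ∃ z ∈ l₁, z ∈ l₂ := by
  intro l₁ l₂ h₁ h₂ hw₁ hw₂ hS₁ hS₂ hhA hlB hhC hlD
  have hrev : ∃ x ∈ l₂.reverse, d ≤ x.2 :=
    ⟨l₂.head h₂, by simp [List.head_mem h₂], by rw [hC _ hhC]; exact hdd'⟩
  obtain ⟨m₁, x, m₂, hmeq, hxb, hm₁⟩ := exists_first_split (p := fun z : ℤ × ℤ => d ≤ z.2) l₂.reverse hrev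
  have hl₂eq : l₂ = m₂.reverse ++ x :: m₁.reverse := by
    have := congrArg List.reverse hmeq
    simpa using this
  set suf := x :: m₁.reverse with hsuf
  have hsufsub : ∀ z ∈ suf, z ∈ l₂ := by
    intro z hz; rw [hl₂eq]; exact List.mem_append_right _ hz
  have hwsuf : IsPlanarWalk suf := by
    have hw : IsPlanarWalk (m₂.reverse ++ suf) := by rw [hsuf, ← hl₂eq]; exact hw₂
    exact (List.isChain_append.1 hw).2.1
  have hlast : suf.getLast (by simp [hsuf]) = l₂.getLast h₂ := by
    rw [List.getLast_congr _ (by simp [hsuf]) hl₂eq]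
    simp [hsuf]
  have hm₁ne : m₁ ≠ [] := by
    intro hm
    have : suf.getLast (by simp [hsuf]) = x := by simp [hsuf, hm]
    rw [hlast] at this
    have h1 := hD _ hlD
    rw [this] at h1
    omega
  have hxeq : x.2 = d := by
    obtain ⟨y, ys, hys⟩ := List.exists_cons_of_ne_nil (show m₁.reverse ≠ [] by simpa using hm₁ne)
    have hy : ¬d ≤ y.2 := hm₁ y (by rw [← List.mem_reverse, hys]; simp)
    have hstep : x = y ∨ planarAdj x y := by
      have : IsPlanarWalk (x :: y :: ys) := by rw [hsuf, hys] at hwsuf; exact hwsuf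
      exact (List.isChain_cons_cons.1 this).1
    rcases hstep with rfl | h
    · exact absurd hxb hy
    · obtain ⟨x1, x2⟩ := x; obtain ⟨y1, y2⟩ := y
      simp only [planarAdj, Prod.mk_add_mk, Prod.mk.injEq, add_zero] at h
      simp only at hxb hy ⊢
      omega
  have hsufS : ∀ z ∈ suf, z ∈ boxR a b c d := by
    intro z hz
    have hzR := hS₂ z (hsufsub z hz)
    rw [mem_boxR_iff] at hzR ⊢
    rw [hsuf, List.mem_cons] at hz
    rcases hz with rfl | hz
    · omega
    · have : ¬d ≤ z.2 := hm₁ z (by rw [← List.mem_reverse]; exact hz)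
      omega
  -- reverse the suffix: a planar walk in `S` from the row `c` to the row `d`
  have hwrev : IsPlanarWalk suf.reverse := by
    rw [IsPlanarWalk, List.isChain_reverse]
    refine hwsuf.imp fun p q h => ?_
    rcases h with h | h
    · exact Or.inl h.symm
    · exact Or.inr (planarAdj_symm h)
  have hne : suf.reverse ≠ [] := by simp [hsuf]
  have hhead' : (suf.reverse.head hne).2 = c := by
    rw [List.head_reverse, hlast]; exact hD _ hlD
  have hlast' : (suf.reverse.getLast hne).2 = d := by
    rw [List.getLast_reverse]; simpa [hsuf] using hxeq
  obtain ⟨z, hz₁, hz₂⟩ := planarCrossing_rect (A := A) (B := B) (C := {z | z.2 = c}) (D := {z | z.2 = d})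
    hA hB (fun z hz => hz) (fun z hz => hz) l₁ suf.reverse h₁ hne hw₁ hwrev hS₁
    (fun z hz => hsufS z (List.mem_reverse.1 hz)) hhA hlB hhead' hlast'
  exact ⟨z, hz₁, hsufsub z (List.mem_reverse.1 hz₂)⟩

/-- **GL0 in the high-probability regime for a top extension** ((3.28) transposed): for every
`k ≥ 1`, `ρ ≥ 2`, `ε > 0`, `η > 0` there is `δ > 0` such that for every `ExtSetup` `E` with `b' = b`
(pure top extension), `A` on the column `x = a`, `C` on the row `y = d'`, `D'` on the row `y = c`,
`dist*(A,C) > 4ρ+8`, `dist*(C,S) > 2ρ+3`, and every `p ∈ [ε,1-ε]`: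
`P_p[A ⟷^S B] ≥ 1-δ` and `P_p[C ⟷^R D'] ≥ 1-δ` imply `P_p[C ⟷^R A] ≥ 1-η`.
[cite: NewmanTassionWu2017, Proposition 3.9 (proof, (3.28)) with Theorem 3.6 (high-probability regime)] -/
theorem glue0_highProb_topExt (k ρ : ℕ) (hk : 1 ≤ k) (hρ : 2 ≤ ρ) {ε : ℝ} (hε : 0 < ε) {η : ℝ} (hη : 0 < η) :
    ∃ δ : ℝ, 0 < δ ∧ ∀ (E : ExtSetup) (Dd : Set (ℤ × ℤ)), E.b' = E.b →
      (∀ z ∈ E.A, z.1 = E.a) → (∀ z ∈ E.C, z.2 = E.d') → (∀ z ∈ Dd, z.2 = E.c) →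
      (∀ a' ∈ E.A, ∀ c' ∈ E.C, c' ∉ sqBox a' (4 * ρ + 8)) →
      (∀ c' ∈ E.C, ∀ s' ∈ E.S, c' ∉ sqBox s' (2 * ρ + 3)) →
      ∀ (p : unitInterval), ε ≤ (p : ℝ) → (p : ℝ) ≤ 1 - ε →
      1 - δ ≤ (bondPercolation (slabGraph 3 k) p).real (E.Q.evAB k) →
      1 - δ ≤ (bondPercolation (slabGraph 3 k) p).real (slabConn k E.R E.C Dd) →
      1 - η ≤ (bondPercolation (slabGraph 3 k) p).real (E.Q.evCA k) := by
  obtain ⟨δ, hδ, H⟩ := glue_highProb_ext k ρ hk hρ hε hη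
  refine ⟨δ / 2, by linarith, fun E Dd hb hA hC hD hsep hfarC p hpε hp1 hAB hCD => ?_⟩
  refine H E hsep hfarC p hpε hp1 ?_
  have hcd : E.c < E.d := by have := E.hcd; omega
  have hcross := cross₂_of_topExt (A := E.Q.A) (B := E.Q.B) (C := E.Q.C) (Dd := Dd) hcd E.hdd' hA
    (fun z hz => (ExtSetup.mem_B_iff.1 hz).2) hC hD
  have h := GlueData.real_evNear_ge_of_cross₂ (Q := E.Q) (k := k) (ρ := ρ) (Dd := Dd) ?_ p
  · have : (bondPercolation (slabGraph 3 k) p).real (slabConn k E.Q.R E.Q.C Dd) =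
        (bondPercolation (slabGraph 3 k) p).real (slabConn k E.R E.C Dd) := rfl
    linarith
  · intro l₁ l₂ h₁ h₂ hw₁ hw₂ hS₁ hS₂ hhA hlB hhC hlD
    refine hcross l₁ l₂ h₁ h₂ hw₁ hw₂ (fun z hz => hS₁ z hz) (fun z hz => ?_) hhA hlB hhC hlD
    have := hS₂ z hz
    show z ∈ boxR E.a E.b E.c E.d'
    have h' : z ∈ boxR E.a E.b' E.c E.d' := this
    rwa [hb] at h'

end NTW17

end Literature.Probability.Percolation

end
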